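import Mathlib
import HarnessLib

/-!
# Initial subspaces of a subspace of a graded coordinate space (torus degenerations, in coordinates)

Topic `Literature/Computability/AlgebraicComplexity`.  Support file for the proof of
`Landsberg2005_borderRank_matMulTensor_two` (`BorderRankMatMulSmall.lean`): the linear algebra of
the TORUS normal form in the border apolarity method (Conner–Harper–Landsberg 2023, §2.4: "we may
assume `I_{ijk}` is `𝔹_T`-fixed"; here only the torus part, which is all the `2 × 2` case needs).
For a coordinate space `K^σ` graded by `deg : σ → ℤ` (the weights of a one-parameter subgroup) and
a subspace `F ≤ K^σ`, the limit `lim_{s→0} λ(s) · F` is the INITIAL subspace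
`in(F) = ⊕_d proj_d (F ∩ V_{≥ d})`; this file provides its graded pieces and their dimension count,
PROVED, with no group theory:

* `projDeg deg d`, `Vge deg d`, `Fge deg F d = F ⊓ V_{≥d}`, `inPart deg F d = proj_d (F ⊓ V_{≥d})`.
* `finrank_Fge_eq_add` — `dim (F ∩ V_{≥d}) = dim in_d(F) + dim (F ∩ V_{≥d+1})` (rank–nullity), and
  the telescoped `finrank_eq_sum_finrank_inPart` — **`dim F = ∑_d dim in_d(F)`** over any window of
  degrees containing `deg(σ)`; `finrank_biSup_inPart_le` — `dim (∑_d in_d F) ≤ dim F`.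
* `inPart_le_of_graded` — if `F ≤ A` with `A` graded then `in_d(F) ≤ A ∩ V_d`;
  `map_inPart_le` — a degree-`e` homogeneous linear map `μ` sends `in_d(F)` into `in_{d+e}(μ F)`.

## References

* A. Conner, A. Harper, J. M. Landsberg, *New lower bounds for matrix multiplication and `det₃`*,
  Forum Math. Pi 11 (2023) e17 = arXiv:1911.07981, §2.4–§2.5 (Borel/torus fixed subspaces: "A
  vector (or line) `w` is a weight vector (line) if the line `[w]` is fixed by the action of `𝕋`").
  [ConnerHarperLandsberg2023]
-/

noncomputable section

open scoped BigOperators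

namespace Literature.Computability.AlgebraicComplexity

universe u w w'

section Initial

variable {K : Type u} [Field K] {σ : Type w} (deg : σ → ℤ)

/-- The projection of `K^σ` onto its degree-`d` coordinates. [folklore] -/
def projDeg (d : ℤ) : (σ → K) →ₗ[K] (σ → K) where
  toFun φ s := if deg s = d then φ s else 0
  map_add' φ ψ := by funext s; by_cases h : deg s = d <;> simp [h]
  map_smul' c φ := by funext s; by_cases h : deg s = d <;> simp [h]

/-- Unfolding lemma for `projDeg`. [folklore] -/
@[simp] theorem projDeg_apply (d : ℤ) (φ : σ → K) (s : σ) :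
    projDeg deg d φ s = if deg s = d then φ s else 0 := rfl

/-- The projection of `K^σ` onto its coordinates of degree `< d`. [folklore] -/
def projLt (d : ℤ) : (σ → K) →ₗ[K] (σ → K) where
  toFun φ s := if deg s < d then φ s else 0
  map_add' φ ψ := by funext s; by_cases h : deg s < d <;> simp [h]
  map_smul' c φ := by funext s; by_cases h : deg s < d <;> simp [h]

/-- `V_{≥ d}`: vectors with no coordinate of degree `< d`. [folklore] -/
def Vge (d : ℤ) : Submodule K (σ → K) := LinearMap.ker (projLt (K := K) deg d)

/-- Membership in `V_{≥ d}`. [folklore] -/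
theorem mem_Vge {d : ℤ} {φ : σ → K} : φ ∈ Vge deg d ↔ ∀ s, deg s < d → φ s = 0 := by
  simp only [Vge, LinearMap.mem_ker]
  constructor
  · intro h s hs
    have := congr_fun h s
    simpa [projLt, hs] using this
  · intro h
    funext s
    by_cases hs : deg s < d
    · simp [projLt, hs, h s hs]
    · simp [projLt, hs]

/-- `F ∩ V_{≥ d}`. [folklore] -/
def Fge (F : Submodule K (σ → K)) (d : ℤ) : Submodule K (σ → K) := F ⊓ Vge deg d

/-- The degree-`d` INITIAL PART `in_d(F) = proj_d (F ∩ V_{≥ d})` of a subspace `F ≤ K^σ` (the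
degree-`d` piece of the torus limit `lim_{s→0} λ(s)·F`). [cite: ConnerHarperLandsberg2023, §2.4] -/
def inPart (F : Submodule K (σ → K)) (d : ℤ) : Submodule K (σ → K) :=
  (Fge deg F d).map (projDeg deg d)

/-- `in_d` is monotone in `F`. [folklore] -/
theorem inPart_mono {F G : Submodule K (σ → K)} (h : F ≤ G) (d : ℤ) :
    inPart deg F d ≤ inPart deg G d :=
  Submodule.map_mono (inf_le_inf_right _ h)

/-- `F ∩ V_{≥ d+1} ≤ F ∩ V_{≥ d}`. [folklore] -/
theorem Fge_succ_le (F : Submodule K (σ → K)) (d : ℤ) : Fge deg F (d + 1) ≤ Fge deg F d := by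
  rintro φ ⟨hF, hV⟩
  refine ⟨hF, (mem_Vge deg).2 fun s hs => (mem_Vge deg).1 hV s (by omega)⟩

/-- `φ ∈ F ∩ V_{≥ d+1}` iff `φ ∈ F ∩ V_{≥ d}` and `proj_d φ = 0`. [folklore] -/
theorem mem_Fge_succ_iff (F : Submodule K (σ → K)) (d : ℤ) (φ : σ → K) :
    φ ∈ Fge deg F (d + 1) ↔ φ ∈ Fge deg F d ∧ projDeg deg d φ = 0 := by
  constructor
  · intro h
    refine ⟨Fge_succ_le deg F d h, ?_⟩
    funext s
    by_cases hs : deg s = d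
    · simp [hs, (mem_Vge deg).1 h.2 s (by omega)]
    · simp [hs]
  · rintro ⟨⟨hF, hV⟩, hp⟩
    refine ⟨hF, (mem_Vge deg).2 fun s hs => ?_⟩
    rcases lt_or_eq_of_le (Int.lt_add_one_iff.1 hs) with h | h
    · exact (mem_Vge deg).1 hV s h
    · have := congr_fun hp s
      simpa [h] using this

/-- Below all degrees, `F ∩ V_{≥ d} = F`. [folklore] -/
theorem Fge_eq_of_le (F : Submodule K (σ → K)) {d : ℤ} (hd : ∀ s, d ≤ deg s) : Fge deg F d = F := by
  apply le_antisymm inf_le_left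
  intro φ hφ
  exact ⟨hφ, (mem_Vge deg).2 fun s hs => absurd (hd s) (not_le.2 hs)⟩

/-- Above all degrees, `F ∩ V_{≥ d} = 0`. [folklore] -/
theorem Fge_eq_bot_of_lt (F : Submodule K (σ → K)) {d : ℤ} (hd : ∀ s, deg s < d) :
    Fge deg F d = ⊥ := by
  rw [eq_bot_iff]
  rintro φ ⟨-, hV⟩
  rw [Submodule.mem_bot]
  funext s
  exact (mem_Vge deg).1 hV s (hd s)

variable [Fintype σ]

/-- **Rank–nullity for one degree**: `dim (F ∩ V_{≥d}) = dim in_d(F) + dim (F ∩ V_{≥d+1})`.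
[folklore] -/
theorem finrank_Fge_eq_add (F : Submodule K (σ → K)) (d : ℤ) :
    Module.finrank K (Fge deg F d) =
      Module.finrank K (inPart deg F d) + Module.finrank K (Fge deg F (d + 1)) := by
  set f := (projDeg (K := K) deg d).domRestrict (Fge deg F d) with hf
  have hrange : LinearMap.range f = inPart deg F d := by
    rw [hf, LinearMap.range_domRestrict]; rfl
  have hker : LinearMap.ker f = (Fge deg F (d + 1)).comap (Fge deg F d).subtype := by
    ext ⟨φ, hφ⟩
    simp only [hf, LinearMap.mem_ker, LinearMap.domRestrict_apply, Submodule.mem_comap,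
      Submodule.subtype_apply]
    rw [mem_Fge_succ_iff]
    tauto
  have h := LinearMap.finrank_range_add_finrank_ker f
  rw [hrange, hker, LinearEquiv.finrank_eq (Submodule.comapSubtypeEquivOfLe (Fge_succ_le deg F d))]
    at h
  exact h.symm

/-- Telescoping `finrank_Fge_eq_add` over `k` consecutive degrees. [folklore] -/
theorem finrank_Fge_eq_sum (F : Submodule K (σ → K)) (d : ℤ) (k : ℕ) :
    Module.finrank K (Fge deg F d) =
      ∑ i ∈ Finset.range k, Module.finrank K (inPart deg F (d + i)) +
        Module.finrank K (Fge deg F (d + k)) := by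
  induction k with
  | zero => rw [Finset.range_zero, Finset.sum_empty, zero_add, Nat.cast_zero, add_zero]
  | succ k ih =>
    rw [Finset.sum_range_succ, ih, Nat.cast_succ, ← add_assoc d, finrank_Fge_eq_add deg F (d + k)]
    ring

/-- **`dim F = ∑_d dim in_d(F)`** over any window `[d, d+k)` of degrees containing `deg(σ)`: the
initial subspace (torus limit) has the dimension of `F`. [cite: ConnerHarperLandsberg2023, §2.4] -/
theorem finrank_eq_sum_finrank_inPart (F : Submodule K (σ → K)) (d : ℤ) (k : ℕ)
    (hlo : ∀ s, d ≤ deg s) (hhi : ∀ s, deg s < d + k) :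
    Module.finrank K F = ∑ i ∈ Finset.range k, Module.finrank K (inPart deg F (d + i)) := by
  have h := finrank_Fge_eq_sum deg F d k
  rwa [Fge_eq_of_le deg F hlo, Fge_eq_bot_of_lt deg F hhi, finrank_bot, add_zero] at h

/-- `dim (∑_{i<k} in_{d+i}(F)) ≤ dim F` (with the window hypotheses of
`finrank_eq_sum_finrank_inPart`). [folklore] -/
theorem finrank_biSup_inPart_le (F : Submodule K (σ → K)) (d : ℤ) (k : ℕ)
    (hlo : ∀ s, d ≤ deg s) (hhi : ∀ s, deg s < d + k) :
    Module.finrank K (⨆ i ∈ Finset.range k, inPart deg F (d + i) : Submodule K (σ → K)) ≤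
      Module.finrank K F := by
  rw [finrank_eq_sum_finrank_inPart deg F d k hlo hhi]
  -- `dim (⨆_{i ∈ s} P i) ≤ ∑_{i ∈ s} dim (P i)` for every finset `s`
  suffices hgen : ∀ s : Finset ℕ,
      Module.finrank K (⨆ i ∈ s, inPart deg F (d + i) : Submodule K (σ → K)) ≤
        ∑ i ∈ s, Module.finrank K (inPart deg F (d + i)) from hgen _
  intro s
  classical
  induction s using Finset.induction_on with
  | empty => simp
  | insert a s ha ih =>
    rw [Finset.iSup_insert, Finset.sum_insert ha]
    exact (Submodule.finrank_add_le_finrank_add_finrank _ _).trans (Nat.add_le_add_left ih _)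

omit [Fintype σ] in
/-- Elements of `in_d(F)` are homogeneous of degree `d`. [folklore] -/
theorem apply_eq_zero_of_mem_inPart {F : Submodule K (σ → K)} {d : ℤ} {φ : σ → K}
    (hφ : φ ∈ inPart deg F d) {s : σ} (hs : deg s ≠ d) : φ s = 0 := by
  obtain ⟨ψ, -, rfl⟩ := Submodule.mem_map.1 hφ
  simp [hs]

omit [Fintype σ] in
/-- If `F ≤ A` and `A` is GRADED (stable under every `proj_d`), then `in_d(F) ≤ A`.
[cite: ConnerHarperLandsberg2023, §2.4] -/
theorem inPart_le_of_graded {F A : Submodule K (σ → K)} (hFA : F ≤ A)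
    (hA : ∀ d, ∀ φ ∈ A, projDeg deg d φ ∈ A) (d : ℤ) : inPart deg F d ≤ A := by
  rintro _ ⟨ψ, hψ, rfl⟩
  exact hA d ψ (hFA hψ.1)

omit [Fintype σ] in
/-- **Homogeneous maps shift initial parts**: if `μ : K^σ → K^τ` maps `V_{≥d}` into `V_{≥d+e}` and
intertwines `proj_d` with `proj_{d+e}`, then `μ (in_d F) ≤ in_{d+e} (μ F)`.
[cite: ConnerHarperLandsberg2023, §2.4] -/
theorem map_inPart_le {τ : Type w'} (degτ : τ → ℤ) (μ : (σ → K) →ₗ[K] (τ → K)) (e : ℤ)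
    (hV : ∀ d, ∀ φ ∈ Vge deg d, μ φ ∈ Vge degτ (d + e))
    (hproj : ∀ d φ, projDeg degτ (d + e) (μ φ) = μ (projDeg deg d φ))
    (F : Submodule K (σ → K)) (d : ℤ) :
    (inPart deg F d).map μ ≤ inPart degτ (F.map μ) (d + e) := by
  rintro _ ⟨_, ⟨ψ, hψ, rfl⟩, rfl⟩
  refine ⟨μ ψ, ⟨Submodule.mem_map_of_mem hψ.1, hV d ψ hψ.2⟩, ?_⟩
  exact hproj d ψ

end Initial

end Literature.Computability.AlgebraicComplexity

end
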